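import Mathlib.Analysis.Calculus.ContDiff.Bounds
import Mathlib.Data.Nat.Choose.Sum
import HarnessLib

/-!
# The BDSV scheme: frequency envelopes (all-orders Leibniz / Faà di Bruno bookkeeping)

Buckmaster–De Lellis–Székelyhidi–Vicol (BDSV), *Onsager's conjecture for admissible weak
solutions*, CPAM 72 (2019) = arXiv:1701.08678, estimate every amplitude of the perturbation step
in the form "`‖f‖_N ≲ A ℓ^{-N}` for all `N`" (Prop. 5.7, Lemma 5.4, the amplitudes `e_{q,i}` in the
proof of Prop. 6.2: "`‖e_{q,i}‖_N ≲ δ_{q+1} ℓ^{-N}`"), and combine such bounds through the product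
rule (A.2) and the chain rule (Prop. A.1). Since every function involved oscillates at frequency
at most `μ = ℓ⁻¹`, the sharp (tame) forms of these rules are never needed: the crude Leibniz and
Faà di Bruno bounds of Mathlib (`ContinuousLinearMap.norm_iteratedFDeriv_le_of_bilinear`,
`norm_iteratedFDeriv_comp_le`) already reproduce `A ℓ^{-N}` with constants depending on `N` only.

This file packages that bookkeeping as a predicate on smooth functions between real normed
spaces,

* `BDSV.HasEnvelope f n A μ`: `f` is `C^∞` and `‖Dⁱ f(x)‖ ≤ A μⁱ` for all `i ≤ n` and all `x`
  (with `0 ≤ A`, `1 ≤ μ`),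

and PROVES its calculus: constants, sums, continuous (bi)linear images (products, scalar
products), one derivative (`A ↦ A μ`), and composition with a smooth map whose derivatives are
bounded on the range (`norm_iteratedFDeriv_comp_le`). It is used for the stationary-phase
estimate in envelope form (`OnsagerBDSVPhaseEnvelope.lean`) and for the principal term of the
energy (Prop. 6.2, `BDSV.energy_principalTerm`).

## References

* T. Buckmaster, C. De Lellis, L. Székelyhidi Jr., V. Vicol, *Onsager's conjecture for admissible
  weak solutions*, Comm. Pure Appl. Math. 72 (2019) 229–274 = arXiv:1701.08678, App. A ((A.2),
  Prop. A.1), §5.5 Prop. 5.7, §6.2 (proof of Prop. 6.2).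
-/

open scoped ContDiff

noncomputable section

namespace Literature.Analysis.FluidPDE

namespace BDSV

variable {E F G H : Type*} [NormedAddCommGroup E] [NormedSpace ℝ E] [NormedAddCommGroup F]
  [NormedSpace ℝ F] [NormedAddCommGroup G] [NormedSpace ℝ G] [NormedAddCommGroup H]
  [NormedSpace ℝ H]

/-- **Frequency envelope.** `HasEnvelope f n A μ`: the function `f` is smooth and its derivatives
of order `i ≤ n` are bounded by `A μⁱ` everywhere ("`‖f‖_i ≤ A μ^i`", the shape of all the
estimates of BDSV Prop. 5.7 / Lemma 5.4 with `μ = ℓ⁻¹`); `0 ≤ A` and `1 ≤ μ` are part of the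
predicate. [cite: BuckmasterEtAl2018, Prop. 5.7 (shape of the estimates)] -/
structure HasEnvelope (f : E → F) (n : ℕ) (A μ : ℝ) : Prop where
  /-- `f` is smooth. -/
  contDiff : ContDiff ℝ ∞ f
  /-- The amplitude is nonnegative. -/
  nonneg : 0 ≤ A
  /-- The frequency is at least one. -/
  one_le : 1 ≤ μ
  /-- `‖Dⁱ f(x)‖ ≤ A μⁱ` for `i ≤ n`. -/
  norm_le : ∀ ⦃i : ℕ⦄, i ≤ n → ∀ x, ‖iteratedFDeriv ℝ i f x‖ ≤ A * μ ^ i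

namespace HasEnvelope

variable {f g : E → F} {n n' : ℕ} {A A' B μ μ' : ℝ}

/-- The frequency of an envelope is nonnegative. [folklore] -/
theorem mu_nonneg (h : HasEnvelope f n A μ) : 0 ≤ μ := zero_le_one.trans h.one_le

/-- Powers of the frequency are at least one. [folklore] -/
theorem one_le_pow (h : HasEnvelope f n A μ) (i : ℕ) : 1 ≤ μ ^ i := one_le_pow₀ h.one_le

/-- The order-zero bound: `‖f(x)‖ ≤ A`. [folklore] -/
theorem norm_le₀ (h : HasEnvelope f n A μ) (x : E) : ‖f x‖ ≤ A := by
  have := h.norm_le (Nat.zero_le n) x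
  rwa [norm_iteratedFDeriv_zero, pow_zero, mul_one] at this

/-- `f` is `Cⁱ` at every point, in the form consumed by Mathlib's `iteratedFDeriv` lemmas. [folklore] -/
theorem contDiffAt (h : HasEnvelope f n A μ) (i : ℕ) (x : E) : ContDiffAt ℝ i f x :=
  h.contDiff.contDiffAt.of_le (WithTop.coe_le_coe.2 le_top)

/-- Monotonicity: fewer derivatives, larger amplitude. [folklore] -/
theorem mono (h : HasEnvelope f n A μ) (hn : n' ≤ n) (hA : A ≤ A') : HasEnvelope f n' A' μ :=
  ⟨h.contDiff, h.nonneg.trans hA, h.one_le, fun _ hi x =>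
    (h.norm_le (hi.trans hn) x).trans (mul_le_mul_of_nonneg_right hA (pow_nonneg h.mu_nonneg _))⟩

/-- Monotonicity in the frequency. [folklore] -/
theorem of_mu_le (h : HasEnvelope f n A μ) (hμ : μ ≤ μ') : HasEnvelope f n A μ' :=
  ⟨h.contDiff, h.nonneg, h.one_le.trans hμ, fun i hi x => (h.norm_le hi x).trans
    (mul_le_mul_of_nonneg_left (pow_le_pow_left₀ h.mu_nonneg hμ i) h.nonneg)⟩

/-- Constants have envelope `(‖c‖, μ)` for every `μ ≥ 1`. [folklore] -/
theorem const (c : F) (n : ℕ) (hμ : 1 ≤ μ) : HasEnvelope (fun _ : E => c) n ‖c‖ μ := by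
  refine ⟨contDiff_const, norm_nonneg _, hμ, fun i _ x => ?_⟩
  rcases Nat.eq_zero_or_pos i with rfl | hi0
  · simp
  · rw [iteratedFDeriv_const_of_ne (Nat.pos_iff_ne_zero.1 hi0)]
    simp only [Pi.zero_apply, norm_zero]
    exact mul_nonneg (norm_nonneg _) (pow_nonneg (zero_le_one.trans hμ) _)

/-- The zero function has every envelope. [folklore] -/
theorem zero (n : ℕ) (hA : 0 ≤ A) (hμ : 1 ≤ μ) : HasEnvelope (fun _ : E => (0 : F)) n A μ :=
  (const (0 : F) n hμ).mono le_rfl (by simpa using hA)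

/-- Sums: amplitudes add. [folklore] -/
theorem add (hf : HasEnvelope f n A μ) (hg : HasEnvelope g n B μ) :
    HasEnvelope (fun x => f x + g x) n (A + B) μ := by
  refine ⟨hf.contDiff.add hg.contDiff, add_nonneg hf.nonneg hg.nonneg, hf.one_le, fun i hi x => ?_⟩
  have h := iteratedFDeriv_add_apply (hf.contDiffAt i x) (hg.contDiffAt i x)
  rw [show f + g = fun x => f x + g x from rfl] at h
  rw [h, add_mul]
  exact (norm_add_le _ _).trans (add_le_add (hf.norm_le hi x) (hg.norm_le hi x))

/-- Negation. [folklore] -/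
theorem neg (hf : HasEnvelope f n A μ) : HasEnvelope (fun x => -f x) n A μ := by
  refine ⟨hf.contDiff.neg, hf.nonneg, hf.one_le, fun i hi x => ?_⟩
  have h := iteratedFDeriv_neg_apply (𝕜 := ℝ) (i := i) (f := f) (x := x)
  rw [show -f = fun x => -f x from rfl] at h
  rw [h, norm_neg]
  exact hf.norm_le hi x

/-- Differences. [folklore] -/
theorem sub (hf : HasEnvelope f n A μ) (hg : HasEnvelope g n B μ) :
    HasEnvelope (fun x => f x - g x) n (A + B) μ := by
  simpa [sub_eq_add_neg] using hf.add hg.neg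

/-- Finite sums: amplitudes add. [folklore] -/
theorem sum {ι : Type*} (s : Finset ι) {f : ι → E → F} {A : ι → ℝ} (hμ : 1 ≤ μ)
    (h : ∀ j ∈ s, HasEnvelope (f j) n (A j) μ) :
    HasEnvelope (fun x => ∑ j ∈ s, f j x) n (∑ j ∈ s, A j) μ := by
  classical
  induction s using Finset.induction_on with
  | empty => simpa using zero (E := E) (F := F) n le_rfl hμ
  | insert a s ha ih =>
    have h' := (h a (Finset.mem_insert_self a s)).add (ih fun j hj => h j (Finset.mem_insert_of_mem hj))
    simpa [Finset.sum_insert ha] using h'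

/-- Continuous linear images: `L ∘ f` has envelope `(‖L‖ A, μ)`. [folklore] -/
theorem clm_comp (L : F →L[ℝ] G) (hf : HasEnvelope f n A μ) :
    HasEnvelope (fun x => L (f x)) n (‖L‖ * A) μ := by
  refine ⟨L.contDiff.comp hf.contDiff, mul_nonneg (norm_nonneg _) hf.nonneg, hf.one_le,
    fun i hi x => ?_⟩
  calc ‖iteratedFDeriv ℝ i (fun x => L (f x)) x‖ ≤ ‖L‖ * ‖iteratedFDeriv ℝ i f x‖ :=
        L.norm_iteratedFDeriv_comp_left (f := f) (hf.contDiffAt i x) le_rfl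
    _ ≤ ‖L‖ * (A * μ ^ i) := mul_le_mul_of_nonneg_left (hf.norm_le hi x) (norm_nonneg _)
    _ = ‖L‖ * A * μ ^ i := by ring

/-- Constant scalar multiples. [folklore] -/
theorem const_smul (c : ℝ) (hf : HasEnvelope f n A μ) :
    HasEnvelope (fun x => c • f x) n (|c| * A) μ := by
  have h := hf.clm_comp (c • ContinuousLinearMap.id ℝ F)
  refine ⟨h.contDiff, mul_nonneg (abs_nonneg c) hf.nonneg, hf.one_le, fun i hi x => ?_⟩
  refine (h.norm_le hi x).trans (mul_le_mul_of_nonneg_right ?_ (pow_nonneg hf.mu_nonneg _))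
  refine mul_le_mul_of_nonneg_right ?_ hf.nonneg
  refine ContinuousLinearMap.opNorm_le_bound _ (abs_nonneg c) fun v => ?_
  simp [norm_smul]

/-- Constant multiples of scalar functions. [folklore] -/
theorem const_mul (c : ℝ) {f : E → ℝ} (hf : HasEnvelope f n A μ) :
    HasEnvelope (fun x => c * f x) n (|c| * A) μ :=
  hf.const_smul c

/-- Pairing with a fixed vector: `x ↦ f(x) • v` has envelope `(A ‖v‖, μ)`. [folklore] -/
theorem smul_const {f : E → ℝ} (hf : HasEnvelope f n A μ) (v : F) :
    HasEnvelope (fun x => f x • v) n (A * ‖v‖) μ := by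
  have h := hf.clm_comp ((ContinuousLinearMap.id ℝ ℝ).smulRight v)
  refine ⟨h.contDiff, mul_nonneg hf.nonneg (norm_nonneg v), hf.one_le, fun i hi x => ?_⟩
  refine (h.norm_le hi x).trans (le_of_eq ?_)
  rw [ContinuousLinearMap.norm_smulRight_apply, ContinuousLinearMap.norm_id, one_mul, mul_comm ‖v‖]

/-- **The Leibniz bound in envelope form** for a continuous bilinear map `B`:
`x ↦ B (f x) (g x)` has envelope `(‖B‖ 2ⁿ A A', μ)` (from
`‖Dⁱ B(f,g)‖ ≤ ‖B‖ ∑ₖ C(i,k) ‖Dᵏf‖ ‖Dⁱ⁻ᵏg‖ ≤ ‖B‖ A A' μⁱ 2ⁱ`; BDSV (A.2) in crude form). [cite: BuckmasterEtAl2018, App. A (A.2)] -/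
theorem bilinear (B : F →L[ℝ] G →L[ℝ] H) {g : E → G} (hf : HasEnvelope f n A μ)
    (hg : HasEnvelope g n A' μ) :
    HasEnvelope (fun x => B (f x) (g x)) n (‖B‖ * 2 ^ n * A * A') μ := by
  refine ⟨B.isBoundedBilinearMap.contDiff.comp (hf.contDiff.prodMk hg.contDiff),
    by have := hf.nonneg; have := hg.nonneg; positivity, hf.one_le, fun i hi x => ?_⟩
  have hμ0 : 0 ≤ μ := hf.mu_nonneg
  calc ‖iteratedFDeriv ℝ i (fun x => B (f x) (g x)) x‖
      ≤ ‖B‖ * ∑ j ∈ Finset.range (i + 1), (i.choose j : ℝ) * ‖iteratedFDeriv ℝ j f x‖ *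
          ‖iteratedFDeriv ℝ (i - j) g x‖ :=
        B.norm_iteratedFDeriv_le_of_bilinear hf.contDiff hg.contDiff x (WithTop.coe_le_coe.2 le_top)
    _ ≤ ‖B‖ * ∑ j ∈ Finset.range (i + 1), (i.choose j : ℝ) * (A * μ ^ j) * (A' * μ ^ (i - j)) := by
        gcongr with j hj
        · exact mul_nonneg (Nat.cast_nonneg _) (mul_nonneg hf.nonneg (pow_nonneg hμ0 _))
        · exact hf.norm_le ((Nat.lt_succ_iff.mp (Finset.mem_range.mp hj)).trans hi) x
        · exact hg.norm_le ((Nat.sub_le i j).trans hi) x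
    _ = ‖B‖ * (A * A' * μ ^ i * ∑ j ∈ Finset.range (i + 1), (i.choose j : ℝ)) := by
        congr 1
        rw [Finset.mul_sum]
        refine Finset.sum_congr rfl fun j hj => ?_
        have hji : j ≤ i := Nat.lt_succ_iff.mp (Finset.mem_range.mp hj)
        have hpow : μ ^ j * μ ^ (i - j) = μ ^ i := by rw [← pow_add, Nat.add_sub_cancel' hji]
        calc (i.choose j : ℝ) * (A * μ ^ j) * (A' * μ ^ (i - j))
            = (i.choose j : ℝ) * A * A' * (μ ^ j * μ ^ (i - j)) := by ring
          _ = A * A' * μ ^ i * (i.choose j : ℝ) := by rw [hpow]; ring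
    _ = ‖B‖ * (A * A' * μ ^ i * 2 ^ i) := by
        rw [← Nat.cast_sum, Nat.sum_range_choose]; push_cast; ring
    _ ≤ ‖B‖ * (A * A' * μ ^ i * 2 ^ n) := by
        gcongr
        · exact mul_nonneg (mul_nonneg hf.nonneg hg.nonneg) (pow_nonneg hμ0 _)
        · norm_num
    _ = ‖B‖ * 2 ^ n * A * A' * μ ^ i := by ring

/-- Products of scalar functions (normed algebra values, e.g. `ℝ` or `ℂ`): envelope
`(2ⁿ A A', μ)`. [cite: BuckmasterEtAl2018, App. A (A.2)] -/
theorem mul {𝔸 : Type*} [NormedRing 𝔸] [NormedAlgebra ℝ 𝔸] {f g : E → 𝔸} (hf : HasEnvelope f n A μ)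
    (hg : HasEnvelope g n A' μ) : HasEnvelope (fun x => f x * g x) n (2 ^ n * A * A') μ := by
  have h := hf.bilinear (ContinuousLinearMap.mul ℝ 𝔸) hg
  refine h.mono le_rfl ?_
  have h1 : ‖ContinuousLinearMap.mul ℝ 𝔸‖ ≤ 1 := ContinuousLinearMap.opNorm_mul_le _ _
  have h0 : 0 ≤ 2 ^ n * A * A' := by have := hf.nonneg; have := hg.nonneg; positivity
  calc ‖ContinuousLinearMap.mul ℝ 𝔸‖ * 2 ^ n * A * A' = ‖ContinuousLinearMap.mul ℝ 𝔸‖ * (2 ^ n * A * A') := by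
        ring
    _ ≤ 1 * (2 ^ n * A * A') := mul_le_mul_of_nonneg_right h1 h0
    _ = 2 ^ n * A * A' := one_mul _

/-- Scalar products `f • g`, `f` real valued (also for complex-valued `g`): envelope
`(2ⁿ A A', μ)`. [cite: BuckmasterEtAl2018, App. A (A.2)] -/
theorem smul {f : E → ℝ} {g : E → F} (hf : HasEnvelope f n A μ) (hg : HasEnvelope g n A' μ) :
    HasEnvelope (fun x => f x • g x) n (2 ^ n * A * A') μ := by
  have h := hf.bilinear (ContinuousLinearMap.lsmul ℝ ℝ : ℝ →L[ℝ] F →L[ℝ] F) hg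
  refine h.mono le_rfl ?_
  have h1 : ‖(ContinuousLinearMap.lsmul ℝ ℝ : ℝ →L[ℝ] F →L[ℝ] F)‖ ≤ 1 :=
    ContinuousLinearMap.opNorm_lsmul_le
  have h0 : 0 ≤ 2 ^ n * A * A' := by have := hf.nonneg; have := hg.nonneg; positivity
  calc ‖(ContinuousLinearMap.lsmul ℝ ℝ : ℝ →L[ℝ] F →L[ℝ] F)‖ * 2 ^ n * A * A'
        = ‖(ContinuousLinearMap.lsmul ℝ ℝ : ℝ →L[ℝ] F →L[ℝ] F)‖ * (2 ^ n * A * A') := by ring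
    _ ≤ 1 * (2 ^ n * A * A') := mul_le_mul_of_nonneg_right h1 h0
    _ = 2 ^ n * A * A' := one_mul _

/-- **One derivative costs one power of the frequency**: if `f` has envelope `(A, μ)` to order
`n + 1`, then `x ↦ Df(x) v` has envelope `(A μ ‖v‖, μ)` to order `n`. [folklore] -/
theorem fderiv_apply (hf : HasEnvelope f (n + 1) A μ) (v : E) :
    HasEnvelope (fun x => fderiv ℝ f x v) n (A * μ * ‖v‖) μ := by
  have hd : ContDiff ℝ ∞ (fderiv ℝ f) := hf.contDiff.fderiv_right le_rfl
  refine ⟨hd.clm_apply contDiff_const, mul_nonneg (mul_nonneg hf.nonneg hf.mu_nonneg) (norm_nonneg _),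
    hf.one_le, fun i hi x => ?_⟩
  calc ‖iteratedFDeriv ℝ i (fun x => fderiv ℝ f x v) x‖ ≤ ‖v‖ * ‖iteratedFDeriv ℝ i (fderiv ℝ f) x‖ :=
        norm_iteratedFDeriv_clm_apply_const (hd.contDiffAt.of_le (WithTop.coe_le_coe.2 le_top)) le_rfl
    _ = ‖v‖ * ‖iteratedFDeriv ℝ (i + 1) f x‖ := by rw [norm_iteratedFDeriv_fderiv]
    _ ≤ ‖v‖ * (A * μ ^ (i + 1)) :=
        mul_le_mul_of_nonneg_left (hf.norm_le (Nat.succ_le_succ hi) x) (norm_nonneg _)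
    _ = A * μ * ‖v‖ * μ ^ i := by ring

/-- **The Faà di Bruno bound in envelope form**: if `g` is smooth with `‖Dⁱ g‖ ≤ C` (`i ≤ n`) on
a set containing the range of `f`, and `f` has envelope `(A, μ)` to order `n`, then `g ∘ f` has
envelope `(n! C max(A,1)ⁿ, μ)` to order `n` (Mathlib's `norm_iteratedFDeriv_comp_le` with
`D = max(A,1) μ`; the crude form of BDSV Prop. A.1). [cite: BuckmasterEtAl2018, App. A Prop. A.1] -/
theorem comp {g : F → G} {S : Set F} {C : ℝ} (hg : ContDiff ℝ ∞ g) (hC0 : 0 ≤ C)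
    (hC : ∀ ⦃i : ℕ⦄, i ≤ n → ∀ y ∈ S, ‖iteratedFDeriv ℝ i g y‖ ≤ C) (hS : ∀ x, f x ∈ S)
    (hf : HasEnvelope f n A μ) :
    HasEnvelope (fun x => g (f x)) n (n.factorial * C * max A 1 ^ n) μ := by
  have hM1 : 1 ≤ max A 1 := le_max_right _ _
  have hM0 : 0 ≤ max A 1 := zero_le_one.trans hM1
  refine ⟨hg.comp hf.contDiff, by positivity, hf.one_le, fun i hi x => ?_⟩
  have hD : ∀ j, 1 ≤ j → j ≤ i → ‖iteratedFDeriv ℝ j f x‖ ≤ (max A 1 * μ) ^ j := by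
    intro j hj1 hji
    refine (hf.norm_le (hji.trans hi) x).trans ?_
    rw [mul_pow]
    refine mul_le_mul_of_nonneg_right ?_ (pow_nonneg hf.mu_nonneg _)
    calc A ≤ max A 1 := le_max_left _ _
      _ = max A 1 ^ 1 := (pow_one _).symm
      _ ≤ max A 1 ^ j := pow_le_pow_right₀ hM1 hj1
  have key := norm_iteratedFDeriv_comp_le (g := g) (f := f) (n := i) (N := (⊤ : ℕ∞))
    hg hf.contDiff (WithTop.coe_le_coe.2 le_top) x (C := C) (D := max A 1 * μ)
    (fun j hj => hC (hj.trans hi) _ (hS x)) hD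
  calc ‖iteratedFDeriv ℝ i (fun x => g (f x)) x‖ = ‖iteratedFDeriv ℝ i (g ∘ f) x‖ := rfl
    _ ≤ i.factorial * C * (max A 1 * μ) ^ i := key
    _ = (i.factorial * C * max A 1 ^ i) * μ ^ i := by rw [mul_pow]; ring
    _ ≤ (n.factorial * C * max A 1 ^ n) * μ ^ i := by
        refine mul_le_mul_of_nonneg_right ?_ (pow_nonneg hf.mu_nonneg _)
        gcongr

end HasEnvelope

end BDSV

end Literature.Analysis.FluidPDE
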